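import Summits.ResolutionOfSingularities.ResolutionOfSingularities.Theorems.HomologicalConductorNoZenoRFirstKindClause
import Summits.ResolutionOfSingularities.ResolutionOfSingularities.Theorems.HomologicalConductorNoZenoRZariskiFactorisation
import Literature.AlgebraicGeometry.Resolution.MinimalResolutionUnique
import HarnessLib

/-!
# Crux `NoZenoR` (stmt-ResolutionOfSingularities-19943) — RELATIVELY MINIMAL desingularizations (Lipman (27.3),
# proof, first paragraph): existence below any desingularization, and comparison with minimality

Route `ResolutionOfSingularities/HomologicalConductor` (cell decomp-res, hand leafhand-res-homologicalconduct-18 g1).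
OURS: AI-written proof over tree theorems, weaker than expert review; nothing here is a statement of the manuscript
under review (Hironaka 2017).  SUPPORT level, counted 0.  Def-free, no new named facts.

A desingularization `f : X → B` is *relatively minimal* when every `B`-morphism from `X` to another desingularization
is an isomorphism (spelled out inline; no definition is introduced).  Lipman, proof of (27.3), p. 277: "If
`g : Z → Y` is a desingularization, then `Z` carries only finitely many exceptional curves (relative to `g`) and
therefore it is clear that `Z` dominates a relatively minimal desingularization `f : X → Y`."

* `isIso_of_isMinimalResolution_of_fac` — a MINIMAL desingularization (`IsMinimalResolution`, universal property) is
  relatively minimal (rigidity `IsResolution.eq_id_of_comp_eq`), over any base;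
* `isMinimalResolution_of_forall_isIso` — conversely, once SOME minimal desingularization exists, a relatively
  minimal one is minimal; `isMinimalResolution_iff_forall_isIso` — the equivalence;
* `ncard_excCurvePoints_succ_le_of_not_isIso` — over a two-dimensional Noetherian local normal domain a
  NON-isomorphic morphism of desingularizations strictly raises the number of integral exceptional curves
  (one-step descent `FirstKind.step` + hand 16 g3's counts);
* **`exists_fac_forall_isIso`** — hence EVERY desingularization of `Spec S` dominates a relatively minimal one;
* `forall_isIso_of_criterionM` — a desingularization satisfying (M) `3·h⁰(𝓘_η) < h⁰(𝓘_η²)` for all its integral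
  exceptional curves is relatively minimal (the first-kind clause (F), `ExcCount.FirstKind.firstKindClause`) — so the
  only input of Lipman (27.3) «⇐» beyond the tree is the EXISTENCE of a minimal desingularization
  (`isMinimalResolution_of_criterionM_of_exists`), not the full Theorem (4.1).

No crux or summit statement is proved here.
-/

noncomputable section

-- single-problem summit: the doubled namespace component `ResolutionOfSingularities` is forced
set_option linter.dupNamespace false

open CategoryTheory AlgebraicGeometry TopologicalSpace Topology IsLocalRing
open Literature.AlgebraicGeometry.Resolution
open Scheme.IdealSheafData
open Summit.ResolutionOfSingularities.ResolutionOfSingularities.Theorems.NoZeno.ExcCount.FirstKind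

namespace Summit.ResolutionOfSingularities.ResolutionOfSingularities.Theorems.NoZeno.FirstKind

universe u

/-! ## §1 Minimal versus relatively minimal (any base) -/

section AnyBase

variable {X B : Scheme.{u}} {f : X ⟶ B}

/-- **A minimal desingularization is relatively minimal**: if `f : X → B` has the universal property
(`IsMinimalResolution`) then every `B`-morphism `k : X → X'` to a desingularization `f' : X' → B` is an isomorphism —
the factorisation `m : X' → X` of `f'` through `f` is a two-sided inverse by rigidity (`IsResolution.eq_id_of_comp_eq`
on `X` and on `X'`). [cite: Badescu2001, Prop. 4.5]; [cite: Lipman1969, Theorem (4.1) (p. 204)] -/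
theorem isIso_of_isMinimalResolution_of_fac (hf : IsMinimalResolution f) {X' : Scheme.{u}} {f' : X' ⟶ B}
    (hf' : IsResolution f') (k : X ⟶ X') (hk : k ≫ f' = f) : IsIso k := by
  obtain ⟨m, hm⟩ := hf.2 X' f' hf'
  have h1 : k ≫ m = 𝟙 X := hf.1.eq_id_of_comp_eq (k ≫ m) (by rw [Category.assoc, hm, hk])
  have h2 : m ≫ k = 𝟙 X' := hf'.eq_id_of_comp_eq (m ≫ k) (by rw [Category.assoc, hk, hm])
  exact ⟨m, h1, h2⟩

/-- **When a minimal desingularization exists, relatively minimal ⇒ minimal**: if SOME `f₀ : X₀ → B` has the universal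
property and every `B`-morphism from the desingularization `f : X → B` to a desingularization is an isomorphism, then
`f` has the universal property (the comparison `X → X₀` is an isomorphism; compose its inverse with the factorisations
through `f₀`). [cite: Lipman1969, Corollary (27.3), proof (p. 277)] -/
theorem isMinimalResolution_of_forall_isIso
    (hmin : ∃ (X₀ : Scheme.{u}) (f₀ : X₀ ⟶ B), IsMinimalResolution f₀) (hf : IsResolution f)
    (hrel : ∀ (X' : Scheme.{u}) (f' : X' ⟶ B) (k : X ⟶ X'), IsResolution f' → k ≫ f' = f → IsIso k) :
    IsMinimalResolution f := by
  obtain ⟨X₀, f₀, hf₀⟩ := hmin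
  obtain ⟨k, hk⟩ := hf₀.2 X f hf
  haveI : IsIso k := hrel X₀ f₀ k hf₀.1 hk
  refine ⟨hf, fun Z g hg => ?_⟩
  obtain ⟨m, hm⟩ := hf₀.2 Z g hg
  refine ⟨m ≫ inv k, ?_⟩
  have hk' : inv k ≫ f = f₀ := by rw [← hk, IsIso.inv_hom_id_assoc]
  rw [Category.assoc, hk', hm]

/-- **Minimal ⟺ relatively minimal, as soon as a minimal desingularization exists.**
[cite: Lipman1969, Corollary (27.3), proof (p. 277)] -/
theorem isMinimalResolution_iff_forall_isIso
    (hmin : ∃ (X₀ : Scheme.{u}) (f₀ : X₀ ⟶ B), IsMinimalResolution f₀) (hf : IsResolution f) :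
    IsMinimalResolution f ↔
      ∀ (X' : Scheme.{u}) (f' : X' ⟶ B) (k : X ⟶ X'), IsResolution f' → k ≫ f' = f → IsIso k :=
  ⟨fun h _ _ k hf' hk => isIso_of_isMinimalResolution_of_fac h hf' k hk,
    isMinimalResolution_of_forall_isIso hmin hf⟩

end AnyBase

/-! ## §2 Over a normal surface singularity: existence of relatively minimal models -/

section Surface

variable {S : Type} [CommRing S] [IsNoetherianRing S] [IsLocalRing S] [IsDomain S] [IsIntegrallyClosed S]

/-- **A non-isomorphic morphism of desingularizations strictly raises the exceptional-curve count**: for `S` a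
two-dimensional Noetherian local normal domain, `ρ : Y → Spec S` and `π : X → Spec S` desingularizations and
`h : X → Y` with `h ≫ ρ = π` NOT an isomorphism, `#excCurvePoints ρ + 1 ≤ #excCurvePoints π` (`h` descends a point
blow-up `b : Y₁ → Y`, `FirstKind.step`; the blow-up adds a curve, `ncard_excCurvePoints_blowup_point`; `X → Y₁` does
not lose curves, `ncard_excCurvePoints_le_of_comp`). [cite: Lipman1969, Corollary (27.3), proof (p. 277)] -/
theorem ncard_excCurvePoints_succ_le_of_not_isIso (h2 : ringKrullDim S = 2) {X Y : Scheme.{0}}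
    {π : X ⟶ Spec (.of S)} {ρ : Y ⟶ Spec (.of S)} {h : X ⟶ Y} (hπ : IsResolution π) (hρ : IsResolution ρ)
    (hfac : h ≫ ρ = π) (hh : ¬ IsIso h) :
    (excCurvePoints ρ).ncard + 1 ≤ (excCurvePoints π).ncard := by
  subst hfac
  obtain ⟨y, hy, hy2, Y₁, b, h₁, hb, hh₁, hbρ⟩ := step h2 hπ hρ hh
  have hc2 := ncard_excCurvePoints_blowup_point h2 ρ hρ hy hy2 b hb hbρ
  have hπ₁ : h₁ ≫ b ≫ ρ = h ≫ ρ := by rw [← Category.assoc, hh₁]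
  have hres₁ : IsResolution (h₁ ≫ b ≫ ρ) := by rw [hπ₁]; exact hπ
  have hc1 := ncard_excCurvePoints_le_of_comp h2 (b ≫ ρ) h₁ hbρ hres₁
  rw [hπ₁] at hc1
  exact hc2.trans hc1

/-- **Every desingularization dominates a relatively minimal one** (Lipman, proof of (27.3), first paragraph: "`Z`
carries only finitely many exceptional curves and therefore it is clear that `Z` dominates a relatively minimal
desingularization").  For `S` a two-dimensional Noetherian local normal domain and a desingularization
`g : Z → Spec S`: there are a desingularization `f : X → Spec S` and an `S`-morphism `k : Z → X` such that every
`S`-morphism from `X` to a desingularization is an isomorphism.  Induction on `#excCurvePoints g`, which drops along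
every non-isomorphic `S`-morphism (`ncard_excCurvePoints_succ_le_of_not_isIso`).
[cite: Lipman1969, Corollary (27.3), proof (p. 277)] -/
theorem exists_fac_forall_isIso (h2 : ringKrullDim S = 2) {Z : Scheme.{0}} {g : Z ⟶ Spec (.of S)}
    (hg : IsResolution g) :
    ∃ (X : Scheme.{0}) (f : X ⟶ Spec (.of S)) (k : Z ⟶ X), IsResolution f ∧ k ≫ f = g ∧
      ∀ (X' : Scheme.{0}) (f' : X' ⟶ Spec (.of S)) (k' : X ⟶ X'), IsResolution f' → k' ≫ f' = f → IsIso k' := by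
  suffices H : ∀ (n : ℕ) (Z : Scheme.{0}) (g : Z ⟶ Spec (.of S)), IsResolution g → (excCurvePoints g).ncard ≤ n →
      ∃ (X : Scheme.{0}) (f : X ⟶ Spec (.of S)) (k : Z ⟶ X), IsResolution f ∧ k ≫ f = g ∧
        ∀ (X' : Scheme.{0}) (f' : X' ⟶ Spec (.of S)) (k' : X ⟶ X'), IsResolution f' → k' ≫ f' = f → IsIso k' from
    H _ Z g hg le_rfl
  intro n
  induction n with
  | zero =>
    intro Z g hg hle
    by_cases hrel : ∀ (X' : Scheme.{0}) (f' : X' ⟶ Spec (.of S)) (k' : Z ⟶ X'),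
        IsResolution f' → k' ≫ f' = g → IsIso k'
    · exact ⟨Z, g, 𝟙 Z, hg, Category.id_comp g, hrel⟩
    · exfalso
      push Not at hrel
      obtain ⟨X', f', k', hf', hk', hne⟩ := hrel
      have := ncard_excCurvePoints_succ_le_of_not_isIso h2 hg hf' hk' hne
      omega
  | succ n ih =>
    intro Z g hg hle
    by_cases hrel : ∀ (X' : Scheme.{0}) (f' : X' ⟶ Spec (.of S)) (k' : Z ⟶ X'),
        IsResolution f' → k' ≫ f' = g → IsIso k'
    · exact ⟨Z, g, 𝟙 Z, hg, Category.id_comp g, hrel⟩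
    · push Not at hrel
      obtain ⟨X', f', k', hf', hk', hne⟩ := hrel
      have hlt := ncard_excCurvePoints_succ_le_of_not_isIso h2 hg hf' hk' hne
      obtain ⟨X, f, k₀, hf, hk₀, hX⟩ := ih X' f' hf' (by omega)
      exact ⟨X, f, k' ≫ k₀, hf, by rw [Category.assoc, hk₀, hk'], hX⟩

/-- **Criterion (M) ⇒ relatively minimal** (unconditional): a desingularization `π : X → Spec S` of a two-dimensional
Noetherian local normal domain with `3·h⁰(𝓘_η) < h⁰(𝓘_η²)` for every integral exceptional curve admits no
non-isomorphic `S`-morphism to another desingularization — such a morphism would force a first-kind curve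
`h⁰(𝓘_η²) = 3·h⁰(𝓘_η)` (the first-kind clause (F), `ExcCount.FirstKind.firstKindClause`).
[cite: Lipman1969, Corollary (27.3) (p. 277)] -/
theorem forall_isIso_of_criterionM (h2 : ringKrullDim S = 2) {X : Scheme.{0}} {π : X ⟶ Spec (.of S)}
    (hπ : IsResolution π)
    (hM : ∀ η ∈ excCurvePoints π, 3 * h0 π (primeDivisorIdeal η) < h0 π (primeDivisorIdeal η ^ 2)) :
    ∀ (Y : Scheme.{0}) (g : Y ⟶ Spec (.of S)) (h : X ⟶ Y), IsResolution g → h ≫ g = π → IsIso h := by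
  intro Y g h hg hfac
  by_contra hh
  obtain ⟨η, hη, hnum⟩ := firstKindClause h2 hπ Y g h hg hfac hh
  have hlt := hM η hη
  rw [hnum] at hlt
  exact lt_irrefl _ hlt

/-- **Lipman (27.3) «⇐» with Theorem (4.1) weakened to the mere EXISTENCE of a minimal desingularization**: if
`Spec S` has some minimal desingularization, then every desingularization satisfying (M) is minimal
(`forall_isIso_of_criterionM` + `isMinimalResolution_of_forall_isIso`).
[cite: Lipman1969, Corollary (27.3) (p. 277; proof pp. 277–278)] -/
theorem isMinimalResolution_of_criterionM_of_exists (h2 : ringKrullDim S = 2)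
    (hmin : ∃ (X₀ : Scheme.{0}) (f₀ : X₀ ⟶ Spec (.of S)), IsMinimalResolution f₀)
    {X : Scheme.{0}} {π : X ⟶ Spec (.of S)} (hπ : IsResolution π)
    (hM : ∀ η ∈ excCurvePoints π, 3 * h0 π (primeDivisorIdeal η) < h0 π (primeDivisorIdeal η ^ 2)) :
    IsMinimalResolution π :=
  isMinimalResolution_of_forall_isIso hmin hπ (forall_isIso_of_criterionM h2 hπ hM)

/-- **Relatively minimal desingularizations exist** (packaged): `Spec S` — `S` a two-dimensional Noetherian local
normal domain admitting a desingularization — has a desingularization through which NO non-isomorphic `S`-morphism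
to a desingularization leaves; if moreover a minimal desingularization exists, this one is minimal.
[cite: Lipman1969, Corollary (27.3), proof (p. 277)] -/
theorem exists_forall_isIso_of_hasResolution (h2 : ringKrullDim S = 2)
    (hres : Scheme.HasResolution (Spec (.of S))) :
    ∃ (X : Scheme.{0}) (f : X ⟶ Spec (.of S)), IsResolution f ∧
      ∀ (X' : Scheme.{0}) (f' : X' ⟶ Spec (.of S)) (k' : X ⟶ X'), IsResolution f' → k' ≫ f' = f → IsIso k' := by
  obtain ⟨Z, g, hg⟩ := hres
  obtain ⟨X, f, -, hf, -, hX⟩ := exists_fac_forall_isIso h2 hg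
  exact ⟨X, f, hf, hX⟩

end Surface

end Summit.ResolutionOfSingularities.ResolutionOfSingularities.Theorems.NoZeno.FirstKind

end
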